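import Summits.BirchSwinnertonDyer.BirchSwinnertonDyer.Theorems.EisensteinPrimesLocalBalanceAtUnramifiedPlace
import Summits.BirchSwinnertonDyer.BirchSwinnertonDyer.Theorems.EisensteinPrimesMazurMCOnCellBTwistbackSubrowPartnerAnyLinePAdicGZ
import HarnessLib

/-!
# Crux 3 `MazurMCOnCellB` (stmt-BirchSwinnertonDyer-19033), line `twistback` v5/v6 — the sub-row doors with the local
# balance FULLY EVALUATED (part 2 of `…LocalBalanceAtUnramifiedPlace`): stub 6′'s (∃-PARTNER) conclusion at a non-split
# X2b pair `(W, 3)` from a rational `3`-line and the identity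
# `1 = Σ_{S₀∖A} s_ℓ[split] + Σ_{A, ℓ∤m, ℓ≡2(3)} s_ℓ + Σ_{A, ℓ∤m, ℓ≡1(3)} 2s_ℓ[ψ(ℓ)=1]`, and what that identity forces

Width seat bsd-line-x2-p1-w7 (gen 2), cell `bsd-eis` (run/shared/lean/pub/bsd-eis/), 2026-08-28. HONEST FRAMING: §1 are
CONDITIONAL doors with the named facts BY NAME exactly as in w3 g10's p657428 `…TwistbackSubrowReducedBalance` and
w3 g11's p661280 `…TwistbackSubrowPartnerAnyLinePAdicGZ` (the route's `PublishedInputs` stmt-…-19037; Disegni 2020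
Thm. 4(1) `padicBSD_rankOne_nonsplitMult` and Thm. 2.4 `padicGrossZagier_nonsplitMult`; Greenberg–Vatsal Thm. (3.11)
`thm311_…`; Dokchitser–Dokchitser 2010 Thm. 1.4 `selmerCorank_mod_two_eq`; Nakagawa–Horie 1988 + Taya 2000 — PUBLISHED;
Keller–Yin Thm. E `thmE_pConverse_semistable_OPEN` — PREPRINT, in the `_of_thmE` door only); §2 is finite-sum
arithmetic. THEOREMS ONLY (no `def`, no named fact introduced, no `sorry`); `--supports` stmt-BirchSwinnertonDyer-19033;
closes no stub by itself; nothing about any curve is proved unconditionally; no summit statement, no Mazur main conjecture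
and no BSD is proved for any curve; 0 cells / labels / tiers move.

* §1 `upperPartner_at_three_of_evaluatedBalance_of_thmE` — p657428's `upperPartner_at_three_of_reducedBalance_of_thmE`
  with its raw additive terms evaluated by part 1's `balance_iff_evaluated_at_three`;
  `upperPartner_at_three_of_evaluatedBalance_of_padicGZ` — the same over the Keller–Yin-FREE door
  `upperPartner_at_three_of_line_of_padicGZ` (p661280; the door the LEAD's v6 `upperPartner_onSubrow` is fed by):
  PUBLISHED named facts only.
* §2 `evaluatedBalance_eq_one_iff` — what balance ONE forces: every evaluated term is `0`, a power of `3` (`≥ 1`), or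
  EVEN, so the identity holds iff NO additive place with `ℓ ∤ m`, `ℓ ≢ 2 (3)` has `ψ(ℓ) = 1` and the «unit-type» places
  (split multiplicative in `S₀ ∖ A`; additive with `ℓ ∤ m`, `ℓ ≡ 2 (3)`) form ONE place `v₀` with `s_{ℓ_{v₀}} = 1`, i.e.
  `ℓ_{v₀} ≢ ±1 (mod 9)` (`sFactor_three_eq_one_iff`) — the per-pair checklist of the sub-row «`c(E) = 1`»
  (30/127 A10 cells by the cell's census CA-g9-1), with `sum_eq_one_iff_of_one_le`, `one_le_sFactor`.

References: [GreenbergVatsal2000] §2 Prop. (2.4) (p. 22), p. 28, §3 Thm. (3.11) and p. 43; [Disegni2020] §2.2 Thm. 2.4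
and §3.2 Thm. 4; [KellerYin2024] Thm. E (PRE; hypothesis of one door); [NakagawaHorie1988] Thm. 1;
[DokchitserDokchitserAnnals2010] Thm. 1.4; [Wuthrich2014] Thm. 16.
-/

set_option autoImplicit false
-- `Summit.BirchSwinnertonDyer.BirchSwinnertonDyer.…`: the summit and its single sub-problem share a name.
set_option linter.dupNamespace false

noncomputable section

open scoped Classical

open NumberField IsDedekindDomain Field WeierstrassCurve DirichletCharacter
  Literature.NumberTheory.EllipticCurves Literature.NumberTheory.GaloisRepresentations
  Literature.NumberTheory.EllipticCurves.GreenbergVatsal2000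
  Literature.NumberTheory.EllipticCurves.Rank1Residual Literature.NumberTheory.EllipticCurves.Rank1Residual.Typed
  Literature.NumberTheory.EllipticCurves.Disegni2020 Literature.NumberTheory.EllipticCurves.KellerYin2024
  Summit.BirchSwinnertonDyer.Rank1Residual Summit.BirchSwinnertonDyer.Rank1Residual.X2
  Summit.BirchSwinnertonDyer.BirchSwinnertonDyer.Theses
  Summit.BirchSwinnertonDyer.BirchSwinnertonDyer.Theorems.EisensteinPrimesLocalBalanceAtUnramifiedPlace
  Summit.BirchSwinnertonDyer.BirchSwinnertonDyer.Theorems.EisensteinPrimesMazurMCOnCellBTwistbackSubrowPartnerAnyLine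
  Summit.BirchSwinnertonDyer.BirchSwinnertonDyer.Theorems.EisensteinPrimesMazurMCOnCellBTwistbackSubrowPartnerAnyLinePAdicGZ

namespace Summit.BirchSwinnertonDyer.BirchSwinnertonDyer.Theorems.EisensteinPrimesMazurMCOnCellBTwistbackSubrowEvaluatedBalance

variable {W : WeierstrassCurve ℚ} {m d : ℕ} {ψ₃ : DirichletCharacter (ZMod 3) d}

/-! ## §1. The sub-row doors with the evaluated balance -/

/-- **Stub 6 (∃-PARTNER) at a non-split X2b pair `(W, 3)` from a rational `3`-line and the EVALUATED balance, `_of_thmE`**: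
w3 g10's p657428 `upperPartner_at_three_of_reducedBalance_of_thmE` with its raw `A`-terms evaluated by part 1's `balance_iff_evaluated_at_three` — the per-pair
input is `1 = Σ_{S₀∖A} s_ℓ[split] + Σ_{A, ℓ∤m, ℓ≡2(3)} s_ℓ + Σ_{A, ℓ∤m, ℓ≡1(3)} 2s_ℓ[ψ(ℓ)=1]`. Named facts BY NAME as
there (`PublishedInputs`; Disegni 2020 Thm. 4(1); GV Thm. (3.11); Dokchitser–Dokchitser; Nakagawa–Horie–Taya — PUB;
Keller–Yin Thm. E — PRE). Conditional; nothing about any curve is proved unconditionally.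
[claim: KellerYin2024, status: under-review] [cite: GreenbergVatsal2000, Thm. (1.3), §2 Prop. (2.4), §3 Thm. (3.11)]
[cite: Disegni2020, Thm. 4 (§3.2)] [cite: NakagawaHorie1988, Thm. 1] [cite: DokchitserDokchitserAnnals2010, Thm. 1.4] -/
theorem upperPartner_at_three_of_evaluatedBalance_of_thmE (hP : EisensteinPrimes.PublishedInputs)
    (hDis : padicBSD_rankOne_nonsplitMult) (h311 : thm311_hasUnitContent_iff_and_order_eq_of_lineRamifiedEven)
    (hDD : ∀ (V : WeierstrassCurve ℚ) [V.IsElliptic] (ℓ : ℕ) [Fact ℓ.Prime], selmerCorank_mod_two_eq V ℓ)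
    (hKY : thmE_pConverse_semistable_OPEN)
    (hNH : Literature.NumberTheory.QuadraticFields.nakagawaHorie_taya_exists_imaginary_h3_eq_one)
    (W : WeierstrassCurve ℚ) [W.IsElliptic] [W.IsGloballyMinimal]
    (hc : X2.CellB W 3) (hns : ¬ W.HasSplitMultiplicativeReductionAtPrime 3)
    {Φ₀ : AddSubgroup (geomTorsion W (3 : ℤ))} (hΦ : IsRationalLine W 3 Φ₀)
    {m : ℕ} [NeZero m] (φ : DirichletCharacter (ZMod 3) m) {d : ℕ} [NeZero d]
    (ψ : DirichletCharacter (ZMod 3) d) (hφ : φ.IsPrimitive) (hψ : ψ.IsPrimitive)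
    (hφ0 : ∀ (σ : absoluteGaloisGroup ℚ), ∀ P ∈ Φ₀,
      σ • P = (φ ((modNCyclotomicCharacter ℚ m σ : (ZMod m)ˣ) : ZMod m)).val • P)
    (hψ0 : ∀ (σ : absoluteGaloisGroup ℚ) (P : geomTorsion W (3 : ℤ)),
      σ • P - (ψ ((modNCyclotomicCharacter ℚ d σ : (ZMod d)ˣ) : ZMod d)).val • P ∈ Φ₀)
    (S₀ : Finset (HeightOneSpectrum (𝓞 ℚ))) (hS₀p : ∀ v ∈ S₀, ((3 : ℕ) : 𝓞 ℚ) ∉ v.asIdeal)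
    (hS : ∀ v : HeightOneSpectrum (𝓞 ℚ), v ∉ S₀ → ((3 : ℕ) : 𝓞 ℚ) ∉ v.asIdeal → W.HasGoodReductionAt v)
    (A : Finset (HeightOneSpectrum (𝓞 ℚ))) (hAS : A ⊆ S₀) (hA : ∀ v ∈ A, W.HasAdditiveReductionAt v)
    (hmult : ∀ v ∈ S₀, v ∉ A → W.HasMultiplicativeReductionAt v)
    (hbal : 1 = ∑ v ∈ S₀ \ A, (if W.HasSplitMultiplicativeReductionAt v
          then sFactor 3 (Rat.HeightOneSpectrum.natGenerator v) else 0) +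
      ∑ v ∈ A, (if Rat.HeightOneSpectrum.natGenerator v ∣ m then 0 else
        if Rat.HeightOneSpectrum.natGenerator v % 3 = 2 then sFactor 3 (Rat.HeightOneSpectrum.natGenerator v)
        else 2 * (if ψ (Rat.HeightOneSpectrum.natGenerator v : ZMod d) = 1
          then sFactor 3 (Rat.HeightOneSpectrum.natGenerator v) else 0))) :
    ∃ (K : Type) (_ : Field K) (_ : NumberField K), IsImaginaryQuadratic K ∧
      SatisfiesHeegnerHypothesis (W.conductorNorm ℤ) K ∧ SatisfiesHeegnerHypothesis 3 K ∧
      Odd (NumberField.discr K) ∧ NumberField.discr K < -4 ∧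
      (W.quadraticTwist (NumberField.discr K : ℚ)).analyticRank = 1 ∧
      ∀ (Wd : WeierstrassCurve ℚ) [Wd.IsElliptic] [Wd.IsGloballyMinimal],
        (∃ C : VariableChange ℚ, C • Wd = W.quadraticTwist (NumberField.discr K : ℚ)) →
        MissingUpperBoundAt Wd 3 :=
  upperPartner_at_three_of_line_of_thmE hP hDis h311 hDD hKY hNH W hc hns hΦ φ ψ hφ hψ hφ0 hψ0 S₀ hS₀p hS
    ((balance_iff_evaluated_at_three hAS hS₀p hA hmult hΦ hφ hψ hφ0 hψ0 1).mpr hbal)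

/-- **The same door, Keller–Yin-FREE (`_of_padicGZ`)**: over w3 g11's `upperPartner_at_three_of_line_of_padicGZ`
(Dokchitser–Dokchitser + Keller–Yin Thm. E replaced by Disegni 2020 Thm. 2.4 `padicGrossZagier_nonsplitMult`), all named
facts PUBLISHED. Conditional; nothing about any curve is proved unconditionally. [cite: Disegni2020, Thm. 2.4 (§2.2) and Thm. 4 (§3.2)]
[cite: GreenbergVatsal2000, Thm. (1.3), §2 Prop. (2.4), §3 Thm. (3.11)] [cite: NakagawaHorie1988, Thm. 1] -/
theorem upperPartner_at_three_of_evaluatedBalance_of_padicGZ (hP : EisensteinPrimes.PublishedInputs)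
    (hDis : padicBSD_rankOne_nonsplitMult) (h311 : thm311_hasUnitContent_iff_and_order_eq_of_lineRamifiedEven)
    (hDGZ : padicGrossZagier_nonsplitMult)
    (hNH : Literature.NumberTheory.QuadraticFields.nakagawaHorie_taya_exists_imaginary_h3_eq_one)
    (W : WeierstrassCurve ℚ) [W.IsElliptic] [W.IsGloballyMinimal]
    (hc : X2.CellB W 3) (hns : ¬ W.HasSplitMultiplicativeReductionAtPrime 3)
    {Φ₀ : AddSubgroup (geomTorsion W (3 : ℤ))} (hΦ : IsRationalLine W 3 Φ₀)
    {m : ℕ} [NeZero m] (φ : DirichletCharacter (ZMod 3) m) {d : ℕ} [NeZero d]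
    (ψ : DirichletCharacter (ZMod 3) d) (hφ : φ.IsPrimitive) (hψ : ψ.IsPrimitive)
    (hφ0 : ∀ (σ : absoluteGaloisGroup ℚ), ∀ P ∈ Φ₀,
      σ • P = (φ ((modNCyclotomicCharacter ℚ m σ : (ZMod m)ˣ) : ZMod m)).val • P)
    (hψ0 : ∀ (σ : absoluteGaloisGroup ℚ) (P : geomTorsion W (3 : ℤ)),
      σ • P - (ψ ((modNCyclotomicCharacter ℚ d σ : (ZMod d)ˣ) : ZMod d)).val • P ∈ Φ₀)
    (S₀ : Finset (HeightOneSpectrum (𝓞 ℚ))) (hS₀p : ∀ v ∈ S₀, ((3 : ℕ) : 𝓞 ℚ) ∉ v.asIdeal)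
    (hS : ∀ v : HeightOneSpectrum (𝓞 ℚ), v ∉ S₀ → ((3 : ℕ) : 𝓞 ℚ) ∉ v.asIdeal → W.HasGoodReductionAt v)
    (A : Finset (HeightOneSpectrum (𝓞 ℚ))) (hAS : A ⊆ S₀) (hA : ∀ v ∈ A, W.HasAdditiveReductionAt v)
    (hmult : ∀ v ∈ S₀, v ∉ A → W.HasMultiplicativeReductionAt v)
    (hbal : 1 = ∑ v ∈ S₀ \ A, (if W.HasSplitMultiplicativeReductionAt v
          then sFactor 3 (Rat.HeightOneSpectrum.natGenerator v) else 0) +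
      ∑ v ∈ A, (if Rat.HeightOneSpectrum.natGenerator v ∣ m then 0 else
        if Rat.HeightOneSpectrum.natGenerator v % 3 = 2 then sFactor 3 (Rat.HeightOneSpectrum.natGenerator v)
        else 2 * (if ψ (Rat.HeightOneSpectrum.natGenerator v : ZMod d) = 1
          then sFactor 3 (Rat.HeightOneSpectrum.natGenerator v) else 0))) :
    ∃ (K : Type) (_ : Field K) (_ : NumberField K), IsImaginaryQuadratic K ∧
      SatisfiesHeegnerHypothesis (W.conductorNorm ℤ) K ∧ SatisfiesHeegnerHypothesis 3 K ∧
      Odd (NumberField.discr K) ∧ NumberField.discr K < -4 ∧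
      (W.quadraticTwist (NumberField.discr K : ℚ)).analyticRank = 1 ∧
      ∀ (Wd : WeierstrassCurve ℚ) [Wd.IsElliptic] [Wd.IsGloballyMinimal],
        (∃ C : VariableChange ℚ, C • Wd = W.quadraticTwist (NumberField.discr K : ℚ)) →
        MissingUpperBoundAt Wd 3 :=
  upperPartner_at_three_of_line_of_padicGZ hP hDis h311 hDGZ hNH W hc hns hΦ φ ψ hφ hψ hφ0 hψ0 S₀ hS₀p hS
    ((balance_iff_evaluated_at_three hAS hS₀p hA hmult hΦ hφ hψ hφ0 hψ0 1).mpr hbal)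

/-! ## §2. What balance ONE forces (arithmetic of the evaluated terms) -/

/-- `s_ℓ ≥ 1` (a power of the prime `q`). [cite: GreenbergVatsal2000, §2 Prop. (2.4) (p. 22)] -/
theorem one_le_sFactor {q : ℕ} (hq : q.Prime) (ℓ : ℕ) : 1 ≤ sFactor q ℓ :=
  Nat.one_le_pow _ _ hq.pos

/-- **`s_ℓ = 1` at `p = 3` iff `9 ∤ ℓ² − 1`** (i.e. `ℓ ≢ ±1 (mod 9)`), for `ℓ ≥ 2`: `s_ℓ = 3^{v₃(ℓ²−1) − 1}`.
[cite: GreenbergVatsal2000, §2 Prop. (2.4) (p. 22) and p. 27 (s_7 = 5 at p = 5)] -/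
theorem sFactor_three_eq_one_iff {ℓ : ℕ} (hℓ : 2 ≤ ℓ) : sFactor 3 ℓ = 1 ↔ ¬ 9 ∣ ℓ ^ 2 - 1 := by
  haveI : Fact (Nat.Prime 3) := ⟨Nat.prime_three⟩
  have hx : ℓ ^ 2 - 1 ≠ 0 := by
    have : 4 ≤ ℓ ^ 2 := by nlinarith
    omega
  have h9 : (9 : ℕ) = 3 ^ 2 := by norm_num
  rw [sFactor, show (3 : ℕ) - 1 = 2 from rfl, Nat.pow_eq_one, h9, padicValNat_dvd_iff_le hx]
  omega

/-- A finite sum of POSITIVE natural numbers equals `1` iff it has exactly one term and that term is `1`. [folklore] -/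
theorem sum_eq_one_iff_of_one_le {ι : Type*} (P : Finset ι) (f : ι → ℕ) (hf : ∀ i ∈ P, 1 ≤ f i) :
    ∑ i ∈ P, f i = 1 ↔ ∃ i, P = {i} ∧ f i = 1 := by
  constructor
  · intro h
    have hne : P.Nonempty := by
      rw [Finset.nonempty_iff_ne_empty]
      rintro rfl
      simp at h
    obtain ⟨i, hi⟩ := hne
    have hsplit := Finset.add_sum_erase P f hi
    rw [h] at hsplit
    have hfi := hf i hi
    have hfi1 : f i = 1 := by omega
    have hrest : ∑ x ∈ P.erase i, f x = 0 := by omega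
    have hempty : P.erase i = ∅ := by
      by_contra hne'
      obtain ⟨j, hj⟩ := Finset.nonempty_iff_ne_empty.mpr hne'
      have hj0 : f j = 0 := Finset.sum_eq_zero_iff.mp hrest j hj
      have := hf j (Finset.mem_of_mem_erase hj)
      omega
    rcases (Finset.erase_eq_empty_iff P i).mp hempty with hP | hP
    · exact absurd hi (hP ▸ Finset.notMem_empty i)
    · exact ⟨i, hP, hfi1⟩
  · rintro ⟨i, rfl, hfi⟩
    rw [Finset.sum_singleton, hfi]

/-- **Balance ONE, decoded (`p = 3`).** In the evaluated balance of part 1 §3 write `U` for the «unit-type» places — split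
multiplicative places of `S₀ ∖ A` and `A`-places with `ℓ ∤ m`, `ℓ ≡ 2 (mod 3)` (each contributes `s_ℓ ≥ 1`) — and note
that an `A`-place with `ℓ ∤ m`, `ℓ ≢ 2 (mod 3)` contributes `2s_ℓ[ψ(ℓ) = 1]`, even. Then the right-hand side equals `1`
iff NO `A`-place with `ℓ ∤ m`, `ℓ ≢ 2 (3)` has `ψ(ℓ) = 1`, and `U` is a single place `v₀` with `s_{ℓ_{v₀}} = 1`
(`ℓ_{v₀} ≢ ±1 (mod 9)`, `sFactor_three_eq_one_iff`). The per-pair checklist of the sub-row «`c(E) = 1`».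
[cite: GreenbergVatsal2000, §2 Prop. (2.4) (p. 22) and §3 p. 43] -/
theorem evaluatedBalance_eq_one_iff {S₀ A : Finset (HeightOneSpectrum (𝓞 ℚ))} :
    (1 = ∑ v ∈ S₀ \ A, (if W.HasSplitMultiplicativeReductionAt v
          then sFactor 3 (Rat.HeightOneSpectrum.natGenerator v) else 0) +
      ∑ v ∈ A, (if Rat.HeightOneSpectrum.natGenerator v ∣ m then 0 else
        if Rat.HeightOneSpectrum.natGenerator v % 3 = 2 then sFactor 3 (Rat.HeightOneSpectrum.natGenerator v)
        else 2 * (if ψ₃ (Rat.HeightOneSpectrum.natGenerator v : ZMod d) = 1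
          then sFactor 3 (Rat.HeightOneSpectrum.natGenerator v) else 0))) ↔
    ((∀ v ∈ A, ¬ Rat.HeightOneSpectrum.natGenerator v ∣ m → Rat.HeightOneSpectrum.natGenerator v % 3 ≠ 2 →
        ψ₃ (Rat.HeightOneSpectrum.natGenerator v : ZMod d) ≠ 1) ∧
      ∃ v₀, ((S₀ \ A).filter (fun v ↦ W.HasSplitMultiplicativeReductionAt v) ∪
          A.filter (fun v ↦ ¬ Rat.HeightOneSpectrum.natGenerator v ∣ m ∧
            Rat.HeightOneSpectrum.natGenerator v % 3 = 2)) = {v₀} ∧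
        sFactor 3 (Rat.HeightOneSpectrum.natGenerator v₀) = 1) := by
  -- abbreviations
  set s : HeightOneSpectrum (𝓞 ℚ) → ℕ := fun v ↦ sFactor 3 (Rat.HeightOneSpectrum.natGenerator v) with hs
  have hs1 : ∀ v, 1 ≤ s v := fun v ↦ one_le_sFactor Nat.prime_three _
  set U₁ := (S₀ \ A).filter (fun v ↦ W.HasSplitMultiplicativeReductionAt v) with hU₁
  set U₂ := A.filter (fun v ↦ ¬ Rat.HeightOneSpectrum.natGenerator v ∣ m ∧
      Rat.HeightOneSpectrum.natGenerator v % 3 = 2) with hU₂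
  set Q := A.filter (fun v ↦ ¬ Rat.HeightOneSpectrum.natGenerator v ∣ m ∧
      Rat.HeightOneSpectrum.natGenerator v % 3 ≠ 2 ∧ ψ₃ (Rat.HeightOneSpectrum.natGenerator v : ZMod d) = 1) with hQ
  -- the multiplicative part as a sum over `U₁`
  have hM : ∑ v ∈ S₀ \ A, (if W.HasSplitMultiplicativeReductionAt v then s v else 0) = ∑ v ∈ U₁, s v := by
    rw [hU₁, Finset.sum_filter]
  -- the additive part as a sum over `U₂` plus twice a sum over `Q`
  have hAdd : ∑ v ∈ A, (if Rat.HeightOneSpectrum.natGenerator v ∣ m then 0 else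
        if Rat.HeightOneSpectrum.natGenerator v % 3 = 2 then s v
        else 2 * (if ψ₃ (Rat.HeightOneSpectrum.natGenerator v : ZMod d) = 1 then s v else 0)) =
      ∑ v ∈ U₂, s v + ∑ v ∈ Q, 2 * s v := by
    rw [hU₂, hQ, Finset.sum_filter, Finset.sum_filter, ← Finset.sum_add_distrib]
    refine Finset.sum_congr rfl fun v _ ↦ ?_
    by_cases h1 : Rat.HeightOneSpectrum.natGenerator v ∣ m
    · simp [h1]
    · by_cases h2 : Rat.HeightOneSpectrum.natGenerator v % 3 = 2
      · simp [h1, h2]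
      · by_cases h3 : ψ₃ (Rat.HeightOneSpectrum.natGenerator v : ZMod d) = 1
        · simp [h1, h2, h3]
        · simp [h1, h2, h3]
  have hdisj : Disjoint U₁ U₂ := by
    rw [hU₁, hU₂, Finset.disjoint_left]
    intro v hv1 hv2
    exact (Finset.mem_sdiff.mp (Finset.mem_filter.mp hv1).1).2 (Finset.mem_filter.mp hv2).1
  have hU : ∑ v ∈ U₁, s v + ∑ v ∈ U₂, s v = ∑ v ∈ U₁ ∪ U₂, s v := (Finset.sum_union hdisj).symm
  -- `Q`-sum vanishes iff `Q = ∅`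
  have hQsum : ∑ v ∈ Q, 2 * s v = 0 ↔ Q = ∅ := by
    constructor
    · intro h
      by_contra hne
      obtain ⟨j, hj⟩ := Finset.nonempty_iff_ne_empty.mpr hne
      have := Finset.sum_eq_zero_iff.mp h j hj
      have := hs1 j
      omega
    · intro hQ0; rw [hQ0, Finset.sum_empty]
  have hQempty : Q = ∅ ↔ ∀ v ∈ A, ¬ Rat.HeightOneSpectrum.natGenerator v ∣ m →
      Rat.HeightOneSpectrum.natGenerator v % 3 ≠ 2 → ψ₃ (Rat.HeightOneSpectrum.natGenerator v : ZMod d) ≠ 1 := by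
    rw [hQ, Finset.filter_eq_empty_iff]
    constructor
    · intro h v hv h1 h2 h3; exact h hv ⟨h1, h2, h3⟩
    · rintro h v hv ⟨h1, h2, h3⟩; exact h v hv h1 h2 h3
  -- assemble
  change (1 = ∑ v ∈ S₀ \ A, (if W.HasSplitMultiplicativeReductionAt v then s v else 0) +
      ∑ v ∈ A, (if Rat.HeightOneSpectrum.natGenerator v ∣ m then 0 else
        if Rat.HeightOneSpectrum.natGenerator v % 3 = 2 then s v
        else 2 * (if ψ₃ (Rat.HeightOneSpectrum.natGenerator v : ZMod d) = 1 then s v else 0))) ↔ _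
  rw [hM, hAdd, ← add_assoc, hU, ← hQempty]
  constructor
  · intro h
    have hpos : 1 ≤ ∑ v ∈ U₁ ∪ U₂, s v ∨ ∑ v ∈ U₁ ∪ U₂, s v = 0 := by omega
    have hQ0 : ∑ v ∈ Q, 2 * s v = 0 := by
      -- the `Q`-sum is even and the total is `1`
      have heven : 2 ∣ ∑ v ∈ Q, 2 * s v := Finset.dvd_sum fun v _ ↦ dvd_mul_right 2 _
      obtain ⟨k, hk⟩ := heven
      omega
    have hU1 : ∑ v ∈ U₁ ∪ U₂, s v = 1 := by omega
    exact ⟨hQsum.mp hQ0, (sum_eq_one_iff_of_one_le _ s fun v _ ↦ hs1 v).mp hU1⟩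
  · rintro ⟨hQ0, v₀, hU0, hs0⟩
    rw [hQsum.mpr hQ0, hU0, Finset.sum_singleton, add_zero]
    exact hs0.symm

end Summit.BirchSwinnertonDyer.BirchSwinnertonDyer.Theorems.EisensteinPrimesMazurMCOnCellBTwistbackSubrowEvaluatedBalance

end
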